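import Summits.BirchSwinnertonDyer.BirchSwinnertonDyer.Theorems.QuadraticBranchSignedControlPlusEtaNonsurjConjADoorBSDRankOneCoeff
import Summits.BirchSwinnertonDyer.BirchSwinnertonDyer.Theorems.QuadraticBranchSignedControlPlusEtaNonsurjConjADoorRecordsPrimeLA
import Summits.BirchSwinnertonDyer.Rank1Residual.X11b.ChaPairsMinimality
import Summits.BirchSwinnertonDyer.Rank1Residual.X11b.KrausMinimalityGeneralTwo
import HarnessLib

/-!
# Route `QuadraticBranchSignedControl` (rung K8, cell `bsd-potss`), residual crux `PlusEtaMainConjectureNonsurj`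
# (stmt-BirchSwinnertonDyer-19606): CONGRUENT-FAMILY `BSD_5` RECORDS RN(c) — `MissingPPartAt W 5` on `λ⁻ = 1` prime-`L` rank-one rows of the congruent
# twist families (doors L6 / L2, g21 census j326603), modulo named published facts and DISPLAYED NUMERICS ONLY (seat `bsd-potss-k8eta-c2` g22)

WHAT. Family members with `ε = −1`, plus-`η` `(λ, μ) = (1, 0)`, `r_an = 1`, a door PASS, and (g19 etacomp j319629) minus-`η` `(λ⁻, μ⁻) = (1, 0)`, `ν = 0`,
`v₅(#Ш_an·Tam/#tors²) = 0`: the crux instance C-cc-1@row follows from these numerics by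
`EtaConjADoorBSDRankOne.minusLeadingValuationAt_zero_of_unit_coeff_of_indivisible` (p724126), so `missingPPartAt_r1n_<tag>_5_…` displays numerics only.
Rows of this part: c5c:37 (`N_W = 218081700`, door L6, Tam = 12, #tors = 1, #Ш_an = 1), c5f:-4 (`N_W = 5468400`, door L6, Tam = 4, #tors = 1, #Ш_an = 1), c5a:-31 (`N_W = 25082100`, door L2, Tam = 24, #tors = 1, #Ш_an = 1). Kernel per curve: `Δ ≠ 0`, global minimality.

HONEST FRAMING (cell `bsd-potss`; FULL-BSD rank ≤ 1 programme, HUMAN RULING D-0036/D-0074): per-row RECORDS, CONDITIONAL on the displayed named facts and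
per-row data (GRH class numbers, PARI `λ^±, μ^±`, `ellanalyticrank` [, `ellrank` generator + `5`-divisibility, `#Ш_an`, `Tam`, `#tors`], the twin `V` with
its tower clause); numerics are evidence, not kernel facts; `BSD(W,5)` ASSERTED for no pair; C-cc-1 NOT proved; no stub of 19606 proved; crux and route OPEN;
nothing booked. `--supports stmt-BirchSwinnertonDyer-19606`.

References: [Kobayashi2003] Thm. 1.2, 2.2, §4, Thm. 4.1, 6.2–7.4, 9.3; [Kobayashi2013]; [KitajimaOtsuki2018] Main Thm. 1.3; [GrossZagier1986] I (7.3);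
[Mazur1978] Cor. 4.1; [Miller2011LMS] Def. 1.1; [CoatesSujatha2005] §3 (A), Thm. 3.4; [NeukirchANT1999] I §9 (Kraus), III §1; [SilvermanAEC2009] VII.1 Rem. 1.1.
-/

set_option autoImplicit false
set_option linter.dupNamespace false
noncomputable section

open scoped Classical nonZeroDivisors

open CongruenceSubgroup NumberField Field WeierstrassCurve
open Literature.NumberTheory.EllipticCurves Literature.NumberTheory.EllipticCurves.ModularForms
  Literature.NumberTheory.EllipticCurves.Rank1Residual Literature.NumberTheory.EllipticCurves.Rank1Residual.Typed
  Literature.NumberTheory.GaloisRepresentations Literature.NumberTheory.GaloisCohomology Literature.NumberTheory.NumberFields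
  Literature.NumberTheory.EllipticCurves.GreenbergVatsal2000 ZpExtension
open Summit.BirchSwinnertonDyer.Rank1Residual Summit.BirchSwinnertonDyer.Rank1Residual.Additive
open Summit.BirchSwinnertonDyer.Rank1Residual.X11b (isElliptic_of_discOf_ne_zero)
open Summit.BirchSwinnertonDyer.BirchSwinnertonDyer.Theorems
open Summit.BirchSwinnertonDyer.Rank1Residual.X11b (isElliptic_of_discOf_ne_zero isGloballyMinimal_of_krausCriterion_support)

namespace Summit.BirchSwinnertonDyer.BirchSwinnertonDyer.Theorems.EtaConjADoorFamilyBSDRecords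

/-- The `5`-partner of c5c:37, `W = [0, 0, 0, -165820125, 646161326125]` (non-CM, `N_W = 218081700`; `j(W) = j(A)` for the quadratic twist
`A^{(37)}` of `A = [0,0,0,−4845,102053]` (non-CM row curve of partner conductor `159300`, `5`-CONGRUENT to a CM row — k8eta-c2 g8; CL25-transfer
class, here settled binder-free)): `Δ ≠ 0` (kernel). [cite: Zywina2015, Thm. 1.4] -/
theorem isElliptic_c5c_37 : (⟨0, 0, 0, (-165820125), 646161326125⟩ : WeierstrassCurve ℚ).IsElliptic :=
  isElliptic_of_discOf_ne_zero 0 0 0 (-165820125) 646161326125 (by decide +kernel)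

set_option maxRecDepth 100000 in
/-- `W = [0, 0, 0, -165820125, 646161326125]` is a global minimal equation (Silverman VII.1 Rem. 1.1 on the support `|Δ| = 2^4 · 3^5 · 5^6 · 37^6 ·
59^5` — at every prime `q` of the support `q¹² ∤ Δ` or `q⁴ ∤ c₄`, or Kraus's test at `2`; tree `isGloballyMinimal_of_krausCriterion_support`, kernel
`decide`). [cite: SilvermanAEC2009, VII.1 Remark 1.1] [cite: Kraus1989, Prop. 1 and Prop. 2] -/
theorem isGloballyMinimal_c5c_37 : (⟨0, 0, 0, (-165820125), 646161326125⟩ : WeierstrassCurve ℚ).IsGloballyMinimal :=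
  isGloballyMinimal_of_krausCriterion_support 0 0 0 (-165820125) 646161326125 [(2, 0, 4), (3, 0, 5), (5, 0, 6), (37, 0, 6), (59, 0, 5)]
    (by
      intro t ht
      simp only [List.mem_cons, List.not_mem_nil, or_false] at ht
      rcases ht with rfl | rfl | rfl | rfl | rfl <;> norm_num)
    (by decide +kernel) (by decide +kernel)

/-- **`MissingPPartAt W 5` — `ord_5 #Ш(W) = ord_5 #Ш_an(W)` (from Miller's `BSDp W 5`) — for the CONGRUENT-class (non-CM, `5`-congruent to a CM row;
k8eta-c2 g8/g19) prime-`L` rank-one partner c5c:37, granted ONE good `a_5 = 0` globally minimal model `V` of `W^{(5)}` with non-onto `5`-adic tower,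
modulo named facts and DISPLAYED NUMERICS ONLY (no conjecture instance: the `λ⁻ = 1` shape)** (`W = [0, 0, 0, -165820125, 646161326125]`, non-CM
(congruent class c5c), `N_W = 218081700`; kit j326603 (k8eta-c2 g21, engine e5.gp) + g19 etanc j317325 + g19 etacomp j319629 (ν, #Ш_an, Tam) (233 s,
GRH): `ε(W) = −1`, PARI plus-`η` `(λ, μ) = (1, 0)`, `r_an(W) = 1` (`g19`); `h(ℚ(P)) = 6` (`[6]`), `h(ℚ(x(P))) = 3`; eigen dimensions `(d₁,d₂,d₃,d₄)
= (0,0,0,0)` — door L6 (`5 ∤ h(ℚ(P))`) passes) from the ROW ALONE — named facts `hGZK hmod hnf hM h12 hKO hGZ h74 h22 h41 h6273` (GZK, modularity,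
newforms, Mazur `p ∤ c₀`, Kobayashi Thm. 1.2 / 2.2 / 4.1 / 6.2–7.4, Kitajima–Otsuki Thm. 1.3, Gross–Zagier I (7.3); Poitou–Tate and the layer
comparison are tree theorems); displayed: `r_an(W) = 1`, the twin `V` with the tower clause, `(L_5⁺(V,η,X)) = (X)`, and — INSTEAD of the crux C-cc-1
at the row — three NUMERICAL data that make its `δ = 0` law trivially true here: (N1) every period-normalised minus branch function `L_5⁻(V,η,X)`
has a UNIT `X`-coefficient (PARI minus-`η` `(λ, μ) = (1, 0)`), (N2) no generator of `W(ℚ)/tors` is `5`-divisible in `W(ℚ_5)` (kit: `ν = 0`), (N3)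
`v_5(q·Tam/#tors²) = 0` for `q = #Ш_an(W)` (kit: `#Ш_an = 1`, `Tam = 12`, `#tors = 1`), the class-group datum. Instance of
`EtaConjADoorBSDRankOne.bsdp_of_plusEtaMainConjectureAt_of_analyticRank_eq_one` ∘ g20's `EtaConjADoorRecords.etaMC_r1_of_classNumber` with `hcc1 :=`
`minusLeadingValuationAt_zero_of_unit_coeff_of_indivisible` (k8eta-c2 g22). CONDITIONAL; nothing booked. [cite: Kobayashi2003, §4 (p. 8), Thm. 2.2
(p. 5)] [cite: CoatesSujatha2005, §3 (A) and Thm. 3.4] [cite: Zywina2015, Thm. 1.4] -/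
theorem missingPPartAt_r1n_c5c_37_5_of_classNumber
    (hGZK : rank_eq_analyticRank_of_analyticRank_le_one) (hmod : hasEntireLFunction_rat)
    (hnf : exists_isNewformOf) (hM : mazur_not_dvd_maninConstant_of_odd)
    (h12 : Kobayashi2003.thm12_signedSelmerDual_finite_torsion)
    (hKO : KitajimaOtsuki2018.mainThm13_etaSignedSelmerDual_noFiniteSubmodule)
    (hGZ : GrossZagier1986_thm_I_7_3) (h74 : Kobayashi2003.thm74_etaEvenMC_iff_etaOddMC)
    (h22 : Kobayashi2003.thm22_etaSignedSelmerDual_finite_torsion)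
    (h41 : Kobayashi2003.thm41_plusEtaCharIdeal_dvd)
    (h6273 : Kobayashi2003.thm62_63_73_etaColemanPoitouTate) [Fact (5 : ℕ).Prime]
    (W : WeierstrassCurve ℚ) (hW : W = (⟨0, 0, 0, (-165820125), 646161326125⟩ : WeierstrassCurve ℚ)) (hr : W.analyticRank = 1)
    (V : WeierstrassCurve ℚ) [V.IsElliptic] [V.IsGloballyMinimal] (C : VariableChange ℚ)
    (hC : C • W.quadraticTwist 5 = V)
    (hgood : V.HasGoodReductionAtPrime 5) (hap : V.frobeniusTrace 5 = 0)
    (hns : ¬ ∀ m : ℕ, V.HasSurjectiveModNGaloisRep (5 ^ m : ℕ))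
    (hX : ∀ {N : ℕ} [NeZero N] {f : CuspForm (Gamma0 N) 2}, IsNewformOf V f →
      ∀ (ϖ : ℚ), (if Even (5 / 2) then (ϖ : ℝ) * V.realPeriodRat = plusPeriod f
          else (ϖ : ℝ) * V.imaginaryPeriodRat = minusPeriod f) →
      ∀ (Lη : IwasawaAlgebra 5), IsQuadraticBranchPlusLFunction f 5 ϖ Lη →
        Ideal.span {Lη} = Ideal.span {(PowerSeries.X : IwasawaAlgebra 5)})
    (hP : haveI : W.IsElliptic := hW ▸ isElliptic_c5c_37
      haveI : NeZero (5 : ℕ) := ⟨by norm_num⟩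
      haveI : NumberField (W.divisionField 5) := NumberField.mk
      ∃ P : geomTorsion W ((5 : ℕ) : ℤ), P ≠ 0 ∧
        ¬ 5 ∣ NumberField.classNumber (IntermediateField.fixedField
          ((MulAction.stabilizer (absoluteGaloisGroup ℚ) P).map (absRestrictNormalHom (W.divisionField 5)))))
    (hcoef : haveI : W.IsElliptic := hW ▸ isElliptic_c5c_37
      ∀ (V' : WeierstrassCurve ℚ) [V'.IsElliptic] [V'.IsGloballyMinimal] (C' : VariableChange ℚ)
        {N : ℕ} [NeZero N] {f : CuspForm (Gamma0 N) 2},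
        C' • W.quadraticTwist 5 = V' → V'.HasGoodReductionAtPrime 5 → V'.frobeniusTrace 5 = 0 → IsNewformOf V' f →
        ∀ (ϖ : ℚ), (if Even (5 / 2) then (ϖ : ℝ) * V'.realPeriodRat = plusPeriod f
            else (ϖ : ℝ) * V'.imaginaryPeriodRat = minusPeriod f) →
        ∀ (L : IwasawaAlgebra 5), IsQuadraticBranchMinusLFunction f 5 ϖ L → IsUnit (PowerSeries.coeff 1 L))
    (hnd : haveI : W.IsElliptic := hW ▸ isElliptic_c5c_37
      ∀ P : W.toAffine.Point, ¬ IsOfFinAddOrder P →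
        (∀ R : W.toAffine.Point, ∃ (k : ℤ) (T : W.toAffine.Point), IsOfFinAddOrder T ∧ R = k • P + T) →
        ∀ Q : (W.baseChange ℚ_[5]).toAffine.Point, 5 • Q ≠ W.toPadicPoint 5 P)
    (hval : haveI : W.IsElliptic := hW ▸ isElliptic_c5c_37
      haveI : W.IsGloballyMinimal := hW ▸ isGloballyMinimal_c5c_37
      ∀ q : ℚ, shaAn W = (q : ℂ) → padicValRat 5 (q * W.tamagawaProduct / (W.torsionOrder : ℚ) ^ 2) = 0) :
    MissingPPartAt W 5 := by
  rw [← show ((-1 : ℚ) ^ ((5 : ℕ) / 2) * ((5 : ℕ) : ℚ)) = (5 : ℚ) by norm_num] at hcoef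
  subst hW
  haveI : (⟨0, 0, 0, (-165820125), 646161326125⟩ : WeierstrassCurve ℚ).IsElliptic := isElliptic_c5c_37
  haveI : (⟨0, 0, 0, (-165820125), 646161326125⟩ : WeierstrassCurve ℚ).IsGloballyMinimal := isGloballyMinimal_c5c_37
  haveI : NeZero (5 : ℕ) := ⟨by norm_num⟩
  haveI : Finite (⟨0, 0, 0, (-165820125), 646161326125⟩ : WeierstrassCurve ℚ).sha := (hGZK _ (by omega)).2
  exact missingPPartAt_of_bsdp _ 5 (EtaConjADoorBSDRankOne.bsdp_of_plusEtaMainConjectureAt_of_analyticRank_eq_one _ 5 hGZK hmod hnf hM h12 hKO hGZ h74 (le_refl 5) V C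
      (by rw [show ((-1 : ℚ) ^ ((5 : ℕ) / 2) * ((5 : ℕ) : ℚ)) = 5 by norm_num]; exact hC) hgood hap
      (EtaConjADoorRecords.etaMC_r1_of_classNumber h22 h41 h6273 hGZK 5 (le_refl 5) _ hr V C
        (by rw [show ((-1 : ℚ) ^ ((5 : ℕ) / 2) * ((5 : ℕ) : ℚ)) = 5 by norm_num]; exact hC) hgood hap hns hX hP) hr
    (EtaConjADoorBSDRankOne.minusLeadingValuationAt_zero_of_unit_coeff_of_indivisible _ 5 hcoef hnd hval))

/-- The `5`-partner of c5f:-4, `W = [0, 0, 0, -336000, -2898000]` (non-CM, `N_W = 5468400`; `j(W) = j(A)` for the quadratic twist `A^{(-4)}` of `A =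
[0,0,1,−840,362]` (non-CM in-table row curve of partner conductor `341775`, `5`-CONGRUENT to a CM row — k8eta-c2 g8; CL25-transfer class, here
settled binder-free)): `Δ ≠ 0` (kernel). [cite: Zywina2015, Thm. 1.4] -/
theorem isElliptic_c5f_m4 : (⟨0, 0, 0, (-336000), (-2898000)⟩ : WeierstrassCurve ℚ).IsElliptic :=
  isElliptic_of_discOf_ne_zero 0 0 0 (-336000) (-2898000) (by decide +kernel)

set_option maxRecDepth 100000 in
/-- `W = [0, 0, 0, -336000, -2898000]` is a global minimal equation (Silverman VII.1 Rem. 1.1 on the support `|Δ| = 2^12 · 3^3 · 5^6 · 7^2 · 31^5` —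
at every prime `q` of the support `q¹² ∤ Δ` or `q⁴ ∤ c₄`, or Kraus's test at `2`; tree `isGloballyMinimal_of_krausCriterion_support`, kernel
`decide`). [cite: SilvermanAEC2009, VII.1 Remark 1.1] [cite: Kraus1989, Prop. 1 and Prop. 2] -/
theorem isGloballyMinimal_c5f_m4 : (⟨0, 0, 0, (-336000), (-2898000)⟩ : WeierstrassCurve ℚ).IsGloballyMinimal :=
  isGloballyMinimal_of_krausCriterion_support 0 0 0 (-336000) (-2898000) [(2, 0, 12), (3, 0, 3), (5, 0, 6), (7, 0, 2), (31, 0, 5)]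
    (by
      intro t ht
      simp only [List.mem_cons, List.not_mem_nil, or_false] at ht
      rcases ht with rfl | rfl | rfl | rfl | rfl <;> norm_num)
    (by decide +kernel) (by decide +kernel)

/-- **`MissingPPartAt W 5` — `ord_5 #Ш(W) = ord_5 #Ш_an(W)` (from Miller's `BSDp W 5`) — for the CONGRUENT-class (non-CM, `5`-congruent to a CM row;
k8eta-c2 g8/g19) prime-`L` rank-one partner c5f:-4, granted ONE good `a_5 = 0` globally minimal model `V` of `W^{(5)}` with non-onto `5`-adic tower,
modulo named facts and DISPLAYED NUMERICS ONLY (no conjecture instance: the `λ⁻ = 1` shape)** (`W = [0, 0, 0, -336000, -2898000]`, non-CM (congruent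
class c5f), `N_W = 5468400`; kit j326603 (k8eta-c2 g21, engine e5.gp) + g19 etanc j317325 + g19 etacomp j319629 (ν, #Ш_an, Tam) (34 s, GRH): `ε(W) =
−1`, PARI plus-`η` `(λ, μ) = (1, 0)`, `r_an(W) = 1` (`g19`); `h(ℚ(P)) = 48` (`[6, 2, 2, 2]`), `h(ℚ(x(P))) = 3`; eigen dimensions `(d₁,d₂,d₃,d₄) =
(0,0,0,0)` — door L6 (`5 ∤ h(ℚ(P))`) passes) from the ROW ALONE — named facts `hGZK hmod hnf hM h12 hKO hGZ h74 h22 h41 h6273` (GZK, modularity,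
newforms, Mazur `p ∤ c₀`, Kobayashi Thm. 1.2 / 2.2 / 4.1 / 6.2–7.4, Kitajima–Otsuki Thm. 1.3, Gross–Zagier I (7.3); Poitou–Tate and the layer
comparison are tree theorems); displayed: `r_an(W) = 1`, the twin `V` with the tower clause, `(L_5⁺(V,η,X)) = (X)`, and — INSTEAD of the crux C-cc-1
at the row — three NUMERICAL data that make its `δ = 0` law trivially true here: (N1) every period-normalised minus branch function `L_5⁻(V,η,X)`
has a UNIT `X`-coefficient (PARI minus-`η` `(λ, μ) = (1, 0)`), (N2) no generator of `W(ℚ)/tors` is `5`-divisible in `W(ℚ_5)` (kit: `ν = 0`), (N3)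
`v_5(q·Tam/#tors²) = 0` for `q = #Ш_an(W)` (kit: `#Ш_an = 1`, `Tam = 4`, `#tors = 1`), the class-group datum. Instance of
`EtaConjADoorBSDRankOne.bsdp_of_plusEtaMainConjectureAt_of_analyticRank_eq_one` ∘ g20's `EtaConjADoorRecords.etaMC_r1_of_classNumber` with `hcc1 :=`
`minusLeadingValuationAt_zero_of_unit_coeff_of_indivisible` (k8eta-c2 g22). CONDITIONAL; nothing booked. [cite: Kobayashi2003, §4 (p. 8), Thm. 2.2
(p. 5)] [cite: CoatesSujatha2005, §3 (A) and Thm. 3.4] [cite: Zywina2015, Thm. 1.4] -/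
theorem missingPPartAt_r1n_c5f_m4_5_of_classNumber
    (hGZK : rank_eq_analyticRank_of_analyticRank_le_one) (hmod : hasEntireLFunction_rat)
    (hnf : exists_isNewformOf) (hM : mazur_not_dvd_maninConstant_of_odd)
    (h12 : Kobayashi2003.thm12_signedSelmerDual_finite_torsion)
    (hKO : KitajimaOtsuki2018.mainThm13_etaSignedSelmerDual_noFiniteSubmodule)
    (hGZ : GrossZagier1986_thm_I_7_3) (h74 : Kobayashi2003.thm74_etaEvenMC_iff_etaOddMC)
    (h22 : Kobayashi2003.thm22_etaSignedSelmerDual_finite_torsion)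
    (h41 : Kobayashi2003.thm41_plusEtaCharIdeal_dvd)
    (h6273 : Kobayashi2003.thm62_63_73_etaColemanPoitouTate) [Fact (5 : ℕ).Prime]
    (W : WeierstrassCurve ℚ) (hW : W = (⟨0, 0, 0, (-336000), (-2898000)⟩ : WeierstrassCurve ℚ)) (hr : W.analyticRank = 1)
    (V : WeierstrassCurve ℚ) [V.IsElliptic] [V.IsGloballyMinimal] (C : VariableChange ℚ)
    (hC : C • W.quadraticTwist 5 = V)
    (hgood : V.HasGoodReductionAtPrime 5) (hap : V.frobeniusTrace 5 = 0)
    (hns : ¬ ∀ m : ℕ, V.HasSurjectiveModNGaloisRep (5 ^ m : ℕ))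
    (hX : ∀ {N : ℕ} [NeZero N] {f : CuspForm (Gamma0 N) 2}, IsNewformOf V f →
      ∀ (ϖ : ℚ), (if Even (5 / 2) then (ϖ : ℝ) * V.realPeriodRat = plusPeriod f
          else (ϖ : ℝ) * V.imaginaryPeriodRat = minusPeriod f) →
      ∀ (Lη : IwasawaAlgebra 5), IsQuadraticBranchPlusLFunction f 5 ϖ Lη →
        Ideal.span {Lη} = Ideal.span {(PowerSeries.X : IwasawaAlgebra 5)})
    (hP : haveI : W.IsElliptic := hW ▸ isElliptic_c5f_m4
      haveI : NeZero (5 : ℕ) := ⟨by norm_num⟩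
      haveI : NumberField (W.divisionField 5) := NumberField.mk
      ∃ P : geomTorsion W ((5 : ℕ) : ℤ), P ≠ 0 ∧
        ¬ 5 ∣ NumberField.classNumber (IntermediateField.fixedField
          ((MulAction.stabilizer (absoluteGaloisGroup ℚ) P).map (absRestrictNormalHom (W.divisionField 5)))))
    (hcoef : haveI : W.IsElliptic := hW ▸ isElliptic_c5f_m4
      ∀ (V' : WeierstrassCurve ℚ) [V'.IsElliptic] [V'.IsGloballyMinimal] (C' : VariableChange ℚ)
        {N : ℕ} [NeZero N] {f : CuspForm (Gamma0 N) 2},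
        C' • W.quadraticTwist 5 = V' → V'.HasGoodReductionAtPrime 5 → V'.frobeniusTrace 5 = 0 → IsNewformOf V' f →
        ∀ (ϖ : ℚ), (if Even (5 / 2) then (ϖ : ℝ) * V'.realPeriodRat = plusPeriod f
            else (ϖ : ℝ) * V'.imaginaryPeriodRat = minusPeriod f) →
        ∀ (L : IwasawaAlgebra 5), IsQuadraticBranchMinusLFunction f 5 ϖ L → IsUnit (PowerSeries.coeff 1 L))
    (hnd : haveI : W.IsElliptic := hW ▸ isElliptic_c5f_m4
      ∀ P : W.toAffine.Point, ¬ IsOfFinAddOrder P →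
        (∀ R : W.toAffine.Point, ∃ (k : ℤ) (T : W.toAffine.Point), IsOfFinAddOrder T ∧ R = k • P + T) →
        ∀ Q : (W.baseChange ℚ_[5]).toAffine.Point, 5 • Q ≠ W.toPadicPoint 5 P)
    (hval : haveI : W.IsElliptic := hW ▸ isElliptic_c5f_m4
      haveI : W.IsGloballyMinimal := hW ▸ isGloballyMinimal_c5f_m4
      ∀ q : ℚ, shaAn W = (q : ℂ) → padicValRat 5 (q * W.tamagawaProduct / (W.torsionOrder : ℚ) ^ 2) = 0) :
    MissingPPartAt W 5 := by
  rw [← show ((-1 : ℚ) ^ ((5 : ℕ) / 2) * ((5 : ℕ) : ℚ)) = (5 : ℚ) by norm_num] at hcoef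
  subst hW
  haveI : (⟨0, 0, 0, (-336000), (-2898000)⟩ : WeierstrassCurve ℚ).IsElliptic := isElliptic_c5f_m4
  haveI : (⟨0, 0, 0, (-336000), (-2898000)⟩ : WeierstrassCurve ℚ).IsGloballyMinimal := isGloballyMinimal_c5f_m4
  haveI : NeZero (5 : ℕ) := ⟨by norm_num⟩
  haveI : Finite (⟨0, 0, 0, (-336000), (-2898000)⟩ : WeierstrassCurve ℚ).sha := (hGZK _ (by omega)).2
  exact missingPPartAt_of_bsdp _ 5 (EtaConjADoorBSDRankOne.bsdp_of_plusEtaMainConjectureAt_of_analyticRank_eq_one _ 5 hGZK hmod hnf hM h12 hKO hGZ h74 (le_refl 5) V C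
      (by rw [show ((-1 : ℚ) ^ ((5 : ℕ) / 2) * ((5 : ℕ) : ℚ)) = 5 by norm_num]; exact hC) hgood hap
      (EtaConjADoorRecords.etaMC_r1_of_classNumber h22 h41 h6273 hGZK 5 (le_refl 5) _ hr V C
        (by rw [show ((-1 : ℚ) ^ ((5 : ℕ) / 2) * ((5 : ℕ) : ℚ)) = 5 by norm_num]; exact hC) hgood hap hns hX hP) hr
    (EtaConjADoorBSDRankOne.minusLeadingValuationAt_zero_of_unit_coeff_of_indivisible _ 5 hcoef hnd hval))

/-- The `5`-partner of c5a:-31, `W = [0, 0, 0, -8288625, -19204023375]` (non-CM, `N_W = 25082100`; `j(W) = j(A)` for the quadratic twist `A^{(-31)}`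
of `A = [0,0,0,−345,5157]` (non-CM in-table row curve of partner conductor `26100`, `5`-CONGRUENT to a CM row of the crux — k8eta-c2 g8 kernel
certificates; CL25-transfer class, here settled binder-free)): `Δ ≠ 0` (kernel). [cite: Zywina2015, Thm. 1.4] -/
theorem isElliptic_c5a_m31 : (⟨0, 0, 0, (-8288625), (-19204023375)⟩ : WeierstrassCurve ℚ).IsElliptic :=
  isElliptic_of_discOf_ne_zero 0 0 0 (-8288625) (-19204023375) (by decide +kernel)

set_option maxRecDepth 100000 in
/-- `W = [0, 0, 0, -8288625, -19204023375]` is a global minimal equation (Silverman VII.1 Rem. 1.1 on the support `|Δ| = 2^4 · 3^3 · 5^6 · 29^5 ·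
31^6` — at every prime `q` of the support `q¹² ∤ Δ` or `q⁴ ∤ c₄`, or Kraus's test at `2`; tree `isGloballyMinimal_of_krausCriterion_support`, kernel
`decide`). [cite: SilvermanAEC2009, VII.1 Remark 1.1] [cite: Kraus1989, Prop. 1 and Prop. 2] -/
theorem isGloballyMinimal_c5a_m31 : (⟨0, 0, 0, (-8288625), (-19204023375)⟩ : WeierstrassCurve ℚ).IsGloballyMinimal :=
  isGloballyMinimal_of_krausCriterion_support 0 0 0 (-8288625) (-19204023375) [(2, 0, 4), (3, 0, 3), (5, 0, 6), (29, 0, 5), (31, 0, 6)]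
    (by
      intro t ht
      simp only [List.mem_cons, List.not_mem_nil, or_false] at ht
      rcases ht with rfl | rfl | rfl | rfl | rfl <;> norm_num)
    (by decide +kernel) (by decide +kernel)

/-- **`MissingPPartAt W 5` — `ord_5 #Ш(W) = ord_5 #Ш_an(W)` (from Miller's `BSDp W 5`) — for the CONGRUENT-class (non-CM, `5`-congruent to a CM row;
k8eta-c2 g8/g19) prime-`L` rank-one partner c5a:-31, granted ONE good `a_5 = 0` globally minimal model `V` of `W^{(5)}` with non-onto `5`-adic
tower, modulo named facts and DISPLAYED NUMERICS ONLY (no conjecture instance: the `λ⁻ = 1` shape)** (`W = [0, 0, 0, -8288625, -19204023375]`,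
non-CM (congruent class c5a), `N_W = 25082100`; kit j326603 (k8eta-c2 g21, engine e5.gp) + g19 etanc j317325 + g19 etacomp j319629 (ν, #Ш_an, Tam)
(241 s, GRH): `ε(W) = −1`, PARI plus-`η` `(λ, μ) = (1, 0)`, `r_an(W) = 1` (`g19`); `h(ℚ(P)) = 40` (`[10, 2, 2]`), `h(ℚ(x(P))) = 1`; eigen dimensions
`(d₁,d₂,d₃,d₄) = (0,0,1,0)` — door L2 (`2` is not an eigenvalue of `σ₂`) passes) from the ROW ALONE — named facts `hGZK hmod hnf hM h12 hKO hGZ h74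
h22 h41 h6273` (GZK, modularity, newforms, Mazur `p ∤ c₀`, Kobayashi Thm. 1.2 / 2.2 / 4.1 / 6.2–7.4, Kitajima–Otsuki Thm. 1.3, Gross–Zagier I (7.3);
Poitou–Tate and the layer comparison are tree theorems); displayed: `r_an(W) = 1`, the twin `V` with the tower clause, `(L_5⁺(V,η,X)) = (X)`, and —
INSTEAD of the crux C-cc-1 at the row — three NUMERICAL data that make its `δ = 0` law trivially true here: (N1) every period-normalised minus
branch function `L_5⁻(V,η,X)` has a UNIT `X`-coefficient (PARI minus-`η` `(λ, μ) = (1, 0)`), (N2) no generator of `W(ℚ)/tors` is `5`-divisible in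
`W(ℚ_5)` (kit: `ν = 0`), (N3) `v_5(q·Tam/#tors²) = 0` for `q = #Ш_an(W)` (kit: `#Ш_an = 1`, `Tam = 24`, `#tors = 1`), the class-group datum.
Instance of `EtaConjADoorBSDRankOne.bsdp_r1_of_eigenHom` with `hcc1 :=` `minusLeadingValuationAt_zero_of_unit_coeff_of_indivisible` (k8eta-c2 g22).
CONDITIONAL; nothing booked. [cite: Kobayashi2003, §4 (p. 8), Thm. 2.2 (p. 5)] [cite: CoatesSujatha2005, §3 (A) and Thm. 3.4] [cite: Zywina2015,
Thm. 1.4] -/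
theorem missingPPartAt_r1n_c5a_m31_5_of_eigenHom
    (hGZK : rank_eq_analyticRank_of_analyticRank_le_one) (hmod : hasEntireLFunction_rat)
    (hnf : exists_isNewformOf) (hM : mazur_not_dvd_maninConstant_of_odd)
    (h12 : Kobayashi2003.thm12_signedSelmerDual_finite_torsion)
    (hKO : KitajimaOtsuki2018.mainThm13_etaSignedSelmerDual_noFiniteSubmodule)
    (hGZ : GrossZagier1986_thm_I_7_3) (h74 : Kobayashi2003.thm74_etaEvenMC_iff_etaOddMC)
    (h22 : Kobayashi2003.thm22_etaSignedSelmerDual_finite_torsion)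
    (h41 : Kobayashi2003.thm41_plusEtaCharIdeal_dvd)
    (h6273 : Kobayashi2003.thm62_63_73_etaColemanPoitouTate) [Fact (5 : ℕ).Prime]
    (W : WeierstrassCurve ℚ) (hW : W = (⟨0, 0, 0, (-8288625), (-19204023375)⟩ : WeierstrassCurve ℚ)) (hr : W.analyticRank = 1)
    (V : WeierstrassCurve ℚ) [V.IsElliptic] [V.IsGloballyMinimal] (C : VariableChange ℚ)
    (hC : C • W.quadraticTwist 5 = V)
    (hgood : V.HasGoodReductionAtPrime 5) (hap : V.frobeniusTrace 5 = 0)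
    (hns : ¬ ∀ m : ℕ, V.HasSurjectiveModNGaloisRep (5 ^ m : ℕ))
    (hX : ∀ {N : ℕ} [NeZero N] {f : CuspForm (Gamma0 N) 2}, IsNewformOf V f →
      ∀ (ϖ : ℚ), (if Even (5 / 2) then (ϖ : ℝ) * V.realPeriodRat = plusPeriod f
          else (ϖ : ℝ) * V.imaginaryPeriodRat = minusPeriod f) →
      ∀ (Lη : IwasawaAlgebra 5), IsQuadraticBranchPlusLFunction f 5 ϖ Lη →
        Ideal.span {Lη} = Ideal.span {(PowerSeries.X : IwasawaAlgebra 5)})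
    (hP : haveI : W.IsElliptic := hW ▸ isElliptic_c5a_m31
      haveI : NeZero (5 : ℕ) := ⟨by norm_num⟩
      haveI : NumberField (W.divisionField 5) := NumberField.mk
      ∃ P : geomTorsion W ((5 : ℕ) : ℤ), P ≠ 0 ∧
        ∀ K : IntermediateField ℚ (W.divisionField 5),
          K = IntermediateField.fixedField
            ((MulAction.stabilizer (absoluteGaloisGroup ℚ) P).map (absRestrictNormalHom (W.divisionField 5))) →
        ∀ μ : Additive (ClassGroup (𝓞 K)) →+ ZMod 5,
          (∀ (τ : absoluteGaloisGroup ℚ) (σ : K ≃ₐ[ℚ] K) (a : ℕ),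
              (∀ x : K, absRestrictNormalHom (W.divisionField 5) τ (x : W.divisionField 5) =
                ((σ x : K) : W.divisionField 5)) → τ • P = a • P →
              ∀ (I J : (Ideal (𝓞 K))⁰),
                (J : Ideal (𝓞 K)) = (I : Ideal (𝓞 K)).map (AmbiguousClass.intAut σ : 𝓞 K →+* 𝓞 K) →
                μ (Additive.ofMul (ClassGroup.mk0 J)) = a • μ (Additive.ofMul (ClassGroup.mk0 I))) →
          μ = 0)
    (hcoef : haveI : W.IsElliptic := hW ▸ isElliptic_c5a_m31
      ∀ (V' : WeierstrassCurve ℚ) [V'.IsElliptic] [V'.IsGloballyMinimal] (C' : VariableChange ℚ)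
        {N : ℕ} [NeZero N] {f : CuspForm (Gamma0 N) 2},
        C' • W.quadraticTwist 5 = V' → V'.HasGoodReductionAtPrime 5 → V'.frobeniusTrace 5 = 0 → IsNewformOf V' f →
        ∀ (ϖ : ℚ), (if Even (5 / 2) then (ϖ : ℝ) * V'.realPeriodRat = plusPeriod f
            else (ϖ : ℝ) * V'.imaginaryPeriodRat = minusPeriod f) →
        ∀ (L : IwasawaAlgebra 5), IsQuadraticBranchMinusLFunction f 5 ϖ L → IsUnit (PowerSeries.coeff 1 L))
    (hnd : haveI : W.IsElliptic := hW ▸ isElliptic_c5a_m31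
      ∀ P : W.toAffine.Point, ¬ IsOfFinAddOrder P →
        (∀ R : W.toAffine.Point, ∃ (k : ℤ) (T : W.toAffine.Point), IsOfFinAddOrder T ∧ R = k • P + T) →
        ∀ Q : (W.baseChange ℚ_[5]).toAffine.Point, 5 • Q ≠ W.toPadicPoint 5 P)
    (hval : haveI : W.IsElliptic := hW ▸ isElliptic_c5a_m31
      haveI : W.IsGloballyMinimal := hW ▸ isGloballyMinimal_c5a_m31
      ∀ q : ℚ, shaAn W = (q : ℂ) → padicValRat 5 (q * W.tamagawaProduct / (W.torsionOrder : ℚ) ^ 2) = 0) :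
    MissingPPartAt W 5 := by
  rw [← show ((-1 : ℚ) ^ ((5 : ℕ) / 2) * ((5 : ℕ) : ℚ)) = (5 : ℚ) by norm_num] at hcoef
  subst hW
  haveI : (⟨0, 0, 0, (-8288625), (-19204023375)⟩ : WeierstrassCurve ℚ).IsElliptic := isElliptic_c5a_m31
  haveI : (⟨0, 0, 0, (-8288625), (-19204023375)⟩ : WeierstrassCurve ℚ).IsGloballyMinimal := isGloballyMinimal_c5a_m31
  haveI : NeZero (5 : ℕ) := ⟨by norm_num⟩
  haveI : Finite (⟨0, 0, 0, (-8288625), (-19204023375)⟩ : WeierstrassCurve ℚ).sha := (hGZK _ (by omega)).2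
  exact missingPPartAt_of_bsdp _ 5 (EtaConjADoorBSDRankOne.bsdp_r1_of_eigenHom _ 5 hGZK hmod hnf hM h12 hKO hGZ h74 h22 h41 h6273 (le_refl 5) hr V C
    (by rw [show ((-1 : ℚ) ^ ((5 : ℕ) / 2) * ((5 : ℕ) : ℚ)) = 5 by norm_num]; exact hC) hgood hap hns hX hP
    (EtaConjADoorBSDRankOne.minusLeadingValuationAt_zero_of_unit_coeff_of_indivisible _ 5 hcoef hnd hval))

end Summit.BirchSwinnertonDyer.BirchSwinnertonDyer.Theorems.EtaConjADoorFamilyBSDRecords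

end
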